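import Summits.BirchSwinnertonDyer.BirchSwinnertonDyer.Theorems.ByReductionTypeAtTwoAdditiveKatoPlusTwoDefs
import Literature.NumberTheory.EllipticCurves.Kato2004.AdditiveNoSplitCyclotomicTwistRankZeroShaUpperBoundFineSelmerAtTwoSharp
import HarnessLib

/-!
# Route ByReductionTypeAtTwo, crux `AdditiveRankZeroAtTwo` (stmt-BirchSwinnertonDyer-19098) — ONE typed research
# target (Theses-free): the SHARP Kato-at-`2` bound on the two additive twist classes `W^{(−1)}` / `W^{(−2)}` split
# multiplicative at `2` = Kato's Main Conjecture 12.10 at the ONE exceptional prime of (12.5.1) (repair-census R-B76;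
# MEMO tier, nothing asserted)

Why this file exists (seat `bsd-2adic-addL2x` GEN 15, 2026-08-28; pattern of `ByReductionTypeAtTwoAdditiveKatoPlusTwoDefs.lean`,
pen ruling RC-307 (β): statements at `p = 2` beyond Kato's printed range are Summits-side `@[conjecture]` constants consumed
BY NAME). The lane's Kato-at-`2` table (Literature readings T1–T17, D-audit PASS ×3; the `+ 2` target T18 =
`AddKatoTwo.KatoPlusTwoAtTwoAdditive`) gives, for every non-CM analytic-rank-`0` curve with irreducible `E[2]` under
statement (A) at `(E,2)`, the bound `ord₂ #Ш + v₂(Tam) ≤ ord₂(L(E,1)/Ω_E) + δ` with `δ = 0` for every reduction type at `2`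
EXCEPT `δ = 2` (resp. `1`) on the ADDITIVE curves whose twist by `−1` (resp. by `−2` only) is SPLIT multiplicative at `2`
(cell census: 169 + 39 of the 1 945 rank-`0` additive classes; 128 + ≈ 30 with irreducible `E[2]`). GEN 14 left ONE
question (R-B76): is that defect real, or an artefact of Kato's printed inequality? This module files the answer as a
typed target — the sharp bound on exactly those two classes — with the analysis below in its docstring, and records (pure
logic) that together with the (NST′) reading it yields the sharp bound for EVERY additive curve and implies T18.

HONEST FRAMING (cell `bsd-2adic`, HUMAN RULING D-0036/D-0054): a typed target, conjecture-grade (it is NOT a reading of a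
printed proof — see «status» below); nothing asserted, nothing booked; BSD is not proved by any of this. PARTITION: X5@2
additive (−1)-split (169) and (−2)-split (39) sub-blocks × p = 2 — types-the-object-of; closes none.

## R-B76: where the defect sits, and what removes it (numbering continues T1–T18)

Notation of T15–T18: `E` additive at `2` with `E^{(d)}` SPLIT multiplicative at `2`, `d ∈ {−1, −2}` (`E ≅ E_q ⊗ χ_d` over
`ℚ₂`), `E[2]` irreducible; `Λ' = ℤ₂[[X]]`, `X = γ − 1`, `γ ↔ 5`; `𝐇'¹(T) = Λ'·b ∋ z' = φ·b = 2^m φ₀ b` (T5/T14: `m ≥ 1`),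
`𝐇'²(T)` torsion with `char = (2^{r_∞} g₀)`; the local term of Kato's Thm. 12.5 (3) is `L' ≅ Λ'/𝔮'`,
`𝔮' = (X − a)`, `a = κ(γ)^{-1}χ_d(γ) − 1 = −4/5` (`d = −1`) resp. `−6/5` (`d = −2`), `v₂(a) = 2` resp. `1` (T16–T18).

* **T19 (a) (the exact ledger).** With `Y' := ker(𝐇'² ↠ L')` (the fine-Selmer-type part; `char Y' = (2^{r_∞} y₀)`,
  `g₀ = y₀·(X − a)`), Kato's printed Thm. 12.5 (3) at the height-one primes `𝔮 ∌ 2` is `y₀ ∣ φ₀` — at `𝔮'` it reads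
  `length(𝐇'²_{𝔮'}) ≤ length((𝐇'¹/z')_{𝔮'}) + 1` (the «`+ length 𝐇²_loc`» of p. 222) — and the identities of T6′/T7′
  give EXACTLY `#S₁(W) = 2^{e+a−t−m}·2^{ord₂ g₀(0) − ord₂ φ₀(0)}`; hence `g₀ ∣ φ₀(X − a)` costs `2^{v₂(a)}` (T17/T18), while
  Kato's CONJECTURE 12.10 (p. 224 — printed for EVERY height-one `𝔭` with `𝔭 ∌ 2`, the exceptional prime of (12.5.1)
  included, whereas Thm. 12.5 (4) prints the local-term-free inequality only «unless f and 𝔭 satisfy (12.5.1)») at the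
  ONE prime `𝔮'` is `length(𝐇'²_{𝔮'}) ≤ length((𝐇'¹/z')_{𝔮'})`, i.e. `g₀ ∣ φ₀` at `𝔮'` too, and then T6–T14 give the
  SHARP bound word for word. So: **the statement below = the lane's reading T1–T18 run with Conj. 12.10 at the single
  prime `𝔮'` in place of Thm. 12.5 (3) there.** (Kernel algebra of this step: `Kato2004.natCard_coinvariants_le_pow_mul_index_zeta_of_lengthAt_le_off_prime`
  — the factor `p^{d·v_p(q_{𝔮₀}(0))}` — and its `d = 0` corollary, file `Kato2004/ZetaIndexInequalityExceptionalPrimeProofs.lean`.)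
* **T19 (b) (consistency: `m = 1`).** Given BSD₂ on such a curve (numerically true on all census classes), the exact
  ledger forces `ord₂ g₀(0) − ord₂ φ₀(0) = m − 1`; Kato allows `≤ v₂(a)`. So EITHER `z'` vanishes at `𝔮'`
  (`φ₀ ∈ 𝔮'`, 12.10 holds at `𝔮'`, and then `m = 1` exactly as on the potentially good classes) OR `m = 1 + v₂(a)`
  (`= 3` for `d = −1`): the defect cannot hide anywhere else.
* **T19 (c) (the structure at `𝔮'`; Greenberg currency).** Over `ℚ₂^cyc` the curve is nearly ordinary:
  `0 → T⁺ = ℤ₂(κχ_d) → T → T⁻ = ℤ₂(χ_d) → 0`, `T⁻ ≅ ℤ₂(1) ⊗ η` with `η = χ_dκ^{-1}` a character of `Γ' = Gal(ℚ₂^cyc/ℚ₂)`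
  (`𝔮' = ker η^{-1}… = (γ − η(γ))`), so `𝒱 := H¹_Iw(ℚ₂, T⁻) ≅ H¹_Iw(ℚ₂, ℤ₂(1)) ⊗ η` is free of rank one at `𝔮'` with its
  universal-norm («Coleman») submodule `U ⊗ η = 𝔮'·𝒱_{𝔮'}` of colength ONE (the valuation quotient
  `H¹_Iw(ℚ₂,ℤ₂(1))/U ≅ Λ'/I` twisted to `Λ'/𝔮'`), and `L' = H²_Iw(ℚ₂, T⁻) = Λ'/𝔮'`. The five-term Poitou–Tate sequence
  `0 → 𝐇'¹ → 𝒱 → X_Gr → 𝐇'² → L' → 0` (`X_Gr` = dual of the Greenberg Selmer group over `ℚ^cyc`; Kato's (17.13.1) with the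
  local term KEPT) gives `ℓ(X_Gr) = ℓ(Y') + ℓ(𝒱/𝐇'¹)`; if the Coleman map of `ℤ₂(1)` carries `loc⁻ z'` to the `χ_d`-branch of
  the 2-adic `L`-function of `E^{(d)}` (Kato Thm. 16.6 / Kobayashi 2006 shape, at `p = 2` a reading owed), then
  `loc⁻ z' ∈ U ⊗ η` (a norm-compatible family of UNITS) vanishes at `𝔮'` to order exactly `1 + ord_{𝔮'} L₂(E^{(d)})`, and
  §17.13's identity at `𝔮'` reads `ℓ(X_Gr) + ℓ(𝐇'¹/z') = ord_{𝔮'}(L₂) + ℓ(𝐇'²)` — the local term (`+1`) and the Coleman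
  colength (`+1`) CANCEL (kernel: `Kato2004.lengthAt_add_eq_of_skeleton_exceptional`). Hence **12.10 at `𝔮'` ⟺
  `ℓ_{𝔮'}(X_Gr) = ord_{𝔮'} L₂(E^{(d)})`** (`…lengthAt_eq_iff_of_skeleton_exceptional`), Kato's theorem giving only
  `≤ … + 1`. NUMERICS (kit j316397, PARI `ellpadicL`, 6 split-multiplicative-at-2 curves of conductor ≤ 342, e.g.
  `54 = [1,−1,1,−29,−53]`): `L₂(E^{(d)})(κ^{±1}) ≠ 0` (2-adic valuations 2…7; the trivial zero at `κ⁰` and `L₂' ≠ 0`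
  confirmed), i.e. `ord_{𝔮'} L₂ = 0` on those curves: there 12.10 at `𝔮'` ⟺ `X_Gr` has NO `𝔮'`-component ⟺ (control at
  the character `κ^{-1}χ_d`) the Greenberg Selmer group of the twisted module `E^{(d)}[2^∞](−1)` over `ℚ` is FINITE — for
  a weight-`1` motive with Greenberg's condition at `2` laxer than Bloch–Kato's by the cyclotomically ramified line; by
  global duality (granting `dim H¹_f(ℚ, V₂E^{(d)}(1)) = 1`, Beilinson) this is the NON-VANISHING of the cyclotomically
  ramified component at `2` of the Beilinson–Kato element of `E^{(d)}` at `s = 0` — a `2`-adic Beilinson-type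
  non-degeneracy. Expected; not in print; not decidable by kit.
* **Status.** CONJECTURE-GRADE (like C1″ 22615): it is Kato's printed Conj. 12.10 at one prime, NOT a reading of a printed
  proof; the Euler-system argument cannot see the local term (the `𝔮'`-specialisations of the tame-level classes are not
  divisible by `𝔮'`), and no base change helps (R-B75a). WHAT IS NOT CLAIMED: the statement itself; anything for reducible
  `E[2]`, CM, analytic rank `1`; any lower bound; `m = 1`.

References: [Kato2004Asterisque] Thm. 12.5 (1)(3)(4), (12.5.1) (pp. 221–222), Conj. 12.10 (p. 224), 13.8 (pp. 227–229), 13.13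
(pp. 233–234), 14.14 and Lemma 14.15 (pp. 243–244), Prop. 14.16 (2) (pp. 244–245), §17.13 (p. 280); [Kato1999Kodai] Thm. 0.8;
[SilvermanATAEC1994] Lemma V.5.2, Thm. V.5.3, Ex. 5.11; [GreenbergLNM1716] §3–§4 (pp. 94, 112–113: `l_v`, `θ^cyc/θ^unr`);
[Kobayashi2006] (MTT at a split multiplicative prime via Kato's element); [CoatesSujatha2005] statement (A); memo
`run/shared/lean/pub/bsd-2adic/addL2x/VERDICT-19098-addL2x-GEN15.md`.
-/

set_option autoImplicit false
set_option linter.dupNamespace false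

noncomputable section

open scoped Classical

open WeierstrassCurve Literature.NumberTheory.EllipticCurves

namespace Summit.BirchSwinnertonDyer.BirchSwinnertonDyer.Theorems.AddKatoTwo

/-- [crux, MEMO] **The SHARP Kato-at-`2` bound on the two additive split-twist classes** — a typed research TARGET
(nothing asserted): for every globally minimal NON-CM `W/ℚ` with ADDITIVE reduction at `2` such that the twist by `−1`
or by `−2` IS split multiplicative at `2` (the complement of the (NST′) reading's hypothesis), `E[2]` irreducible,
`L(E,1) ≠ 0`, `Ш(E/ℚ)` finite, and statement (A) at `(E,2)` in the `∃ γ D` spelling, there is `q ∈ ℚ` with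
`L(E,1)/Ω(W) = q` and `ord₂ #Ш(E/ℚ)(2) + v₂(Tam(W)) ≤ ord₂ q`. CONTENT (module docstring, T19): the lane's reading
T1–T18 with Kato's printed Thm. 12.5 (3) replaced, at the ONE exceptional height-one prime `𝔮'` of (12.5.1)
(`(X + 4/5)` resp. `(X + 6/5)`), by Kato's printed CONJECTURE 12.10 at that prime; equivalently (granting the Coleman-map
reading at `2`) `length_{𝔮'} X_Gr(E/ℚ^cyc) = ord_{𝔮'} L₂(E^{(d)})`, numerically `= 0` (kit j316397). Conjecture-grade —
NOT a reading of a proof; BSD predicts it; nothing for reducible `E[2]`. Same binders as the (NST′) Literature fact with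
its twist hypothesis NEGATED. [cite: Kato2004Asterisque, Conj. 12.10 (p. 224); Thm. 12.5 (3)(4) and (12.5.1) (p. 222); 13.13 (pp. 233–234); 14.14 and Lemma 14.15 (pp. 243–244)]
[cite: CoatesSujatha2005, statement (A) (the hypothesis)] -/
@[conjecture] def KatoSharpAtTwoAdditiveSplitTwist : Prop :=
  ∀ (W : WeierstrassCurve ℚ) [W.IsElliptic] [W.IsGloballyMinimal], ¬ W.HasCM →
    ¬ W.HasGoodReductionAtPrime 2 → ¬ W.HasMultiplicativeReductionAtPrime 2 →
    ¬ (∀ d : ℚ, d = -1 ∨ d = -2 → ¬ (W.quadraticTwist d).HasSplitMultiplicativeReductionAtPrime 2) →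
    W.HasIrreducibleModPGaloisRep 2 →
    (∀ (κ : ZpExtension ℚ 2), κ.IsCyclotomic →
      ∃ (γ : Field.absoluteGaloisGroup ℚ) (D : W.FineSelmerDualData κ γ),
        Module.Finite ℤ_[2] (RestrictScalars ℤ_[2] (IwasawaAlgebra 2) D.X)) →
    W.entireLFunction 1 ≠ 0 → Finite W.sha →
    ∃ q : ℚ, W.entireLFunction 1 / (W.realPeriodRat : ℂ) = (q : ℂ) ∧
      (padicValNat 2 (Nat.card (AddCommGroup.primaryComponent W.sha 2)) : ℤ) +
          padicValNat 2 W.tamagawaProduct ≤ padicValRat 2 q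

/-- **The sharp Kato-at-`2` bound for EVERY additive curve with irreducible `E[2]`** (no twist hypothesis) from the
(NST′) Literature reading (`hNST2`, D-audit PASS) on its half and the target `KatoSharpAtTwoAdditiveSplitTwist` on the
complementary half — pure logic (case split on (NST′)). [cite: Kato2004Asterisque, Thm. 12.5 (3) and (12.5.1) (p. 222), Conj. 12.10 (p. 224)] -/
theorem katoSharpAtTwoAdditive_of_reading_of_splitTwist
    (hNST2 : Kato2004.rankZero_padicValNat_sha_add_padicValNat_tamagawa_le_at_two_of_noSplitTwistNegOneNegTwo_of_irreducible_of_fineSelmerDual_fg)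
    (hX : KatoSharpAtTwoAdditiveSplitTwist) :
    ∀ (W : WeierstrassCurve ℚ) [W.IsElliptic] [W.IsGloballyMinimal], ¬ W.HasCM →
      ¬ W.HasGoodReductionAtPrime 2 → ¬ W.HasMultiplicativeReductionAtPrime 2 →
      W.HasIrreducibleModPGaloisRep 2 →
      (∀ (κ : ZpExtension ℚ 2), κ.IsCyclotomic →
        ∃ (γ : Field.absoluteGaloisGroup ℚ) (D : W.FineSelmerDualData κ γ),
          Module.Finite ℤ_[2] (RestrictScalars ℤ_[2] (IwasawaAlgebra 2) D.X)) →
      W.entireLFunction 1 ≠ 0 → Finite W.sha →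
      ∃ q : ℚ, W.entireLFunction 1 / (W.realPeriodRat : ℂ) = (q : ℂ) ∧
        (padicValNat 2 (Nat.card (AddCommGroup.primaryComponent W.sha 2)) : ℤ) +
            padicValNat 2 W.tamagawaProduct ≤ padicValRat 2 q := by
  intro W _ _ hcm hgood hmult hirr hA hL hfin
  by_cases hnst : ∀ d : ℚ, d = -1 ∨ d = -2 → ¬ (W.quadraticTwist d).HasSplitMultiplicativeReductionAtPrime 2
  · exact hNST2 W hcm hgood hmult hnst hirr hA hL hfin
  · exact hX W hcm hgood hmult hnst hirr hA hL hfin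

/-- **The new target and the (NST″) `+ 1` reading imply the old `+ 2` target `KatoPlusTwoAtTwoAdditive`** (T18) — pure
logic (`+ 0 ≤ + 2`, `+ 1 ≤ + 2`); recorded so that the planner sees that `KatoSharpAtTwoAdditiveSplitTwist` REFINES T18 on
its two classes and is the only Kato-side object left on the additive block with irreducible `E[2]`.
[cite: Kato2004Asterisque, Thm. 12.5 (3) (p. 222), Conj. 12.10 (p. 224)] -/
theorem katoPlusTwoAtTwoAdditive_of_plusOne_of_splitTwist
    (h1 : Kato2004.rankZero_padicValNat_sha_add_padicValNat_tamagawa_le_add_one_at_two_of_noSplitTwistNegOne_of_irreducible_of_fineSelmerDual_fg)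
    (hX : KatoSharpAtTwoAdditiveSplitTwist) : KatoPlusTwoAtTwoAdditive := by
  intro W _ _ hcm hgood hmult hirr hA hL hfin
  by_cases hneg : (W.quadraticTwist (-1)).HasSplitMultiplicativeReductionAtPrime 2
  · have hnst : ¬ (∀ d : ℚ, d = -1 ∨ d = -2 →
        ¬ (W.quadraticTwist d).HasSplitMultiplicativeReductionAtPrime 2) :=
      fun h => h (-1) (Or.inl rfl) hneg
    obtain ⟨q, hq, hle⟩ := hX W hcm hgood hmult hnst hirr hA hL hfin
    exact ⟨q, hq, by linarith⟩
  · obtain ⟨q, hq, hle⟩ := h1 W hcm hgood hmult hneg hirr hA hL hfin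
    exact ⟨q, hq, by linarith⟩

end Summit.BirchSwinnertonDyer.BirchSwinnertonDyer.Theorems.AddKatoTwo

end
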